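import Summits.BirchSwinnertonDyer.BirchSwinnertonDyer.Theorems.ClassRecordThreeShimuraKolyvaginOrderBoundAtThreeSurjOrderBound
import Literature.NumberTheory.EllipticCurves.HeegnerPointsKolyvaginPrimaryShaBoundProofs
import HarnessLib

/-!
# Kolyvagin's ORDER bound for Heegner-type Euler systems, keyed on the CONDUCTOR — part 5: McCallum 1991
# §1 Theorem on `Ш(E/K)[p^∞]`: finite, killed by `p^{M₀}`, `#Ш(E/K)[p^∞] ≤ p^{2M₀}`

Cell `bsd-stepL` (run/shared/lean/pub/bsd-stepL/), seat `bsd-stepL-shim3a` (prover g2), HELPER for the crux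
`Summit.BirchSwinnertonDyer.BirchSwinnertonDyer.Theses.ClassRecordThree.ShimuraKolyvaginOrderBoundAtThreeSurj`
(item stmt-BirchSwinnertonDyer-19899; `--supports … --as helper`); serves S2 of item 19718 and item 19627 too.
Road memo HOME/shim/SHIM3A-G2-ROAD-19899.md §2 (ε₃). Sequel of `…SurjOrderBound.lean` (part 4).

## What

`card_sha_primaryComponent_le_of_localTerm_of_conductorNorm` — conductor-keyed twin of x11b3's
`KolyvaginDescent.card_sha_primaryComponent_le_of_localTerm` (the Kummer sequence `S_{m²}/ℤx ↠ Ш[m]` and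
`Ш[p^∞] = Ш[p^{M₀}]` applied to part 4's Selmer bound), statement = the tree's with the Heegner-point binder
replaced by `hN : W.conductorNorm ℤ = N₀`, proof = the tree's; §1 re-proves that file's PRIVATE descent
helpers (`Ш[m²] ⊆ Ш[m] ⟹ Ш[m^{k+1}] ⊆ Ш[m]`, `Ш[p^∞] = Ш[p^{M₀}]`) verbatim, since they are not importable.

## Honest framing

THEOREMS ONLY (no `def`, no named fact, no `sorry`; axioms standard). Nothing here constructs an Euler system
or discharges a Cassels–Tate input; item 19899 stays OPEN. BSD is not proved by any of this.

## References

[cite: McCallumLMS1991, §1 Theorem, Thm. 4.5, Thm. 5.4, Cor. 5.6] [cite: GrossLMS1991, §2 Thm. 2.2 (2)]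
[cite: MilneADT2006, Ch. I §6, (6.14), Prop. 6.9, Thm. 6.13(a)] [cite: SilvermanAEC2009, Thm. X.4.2]
presearch: not applicable (re-keying of tree theorems). Tree: `lean search 'card_sha_primaryComponent_le_of_localTerm_of_conductorNorm'` → none.
-/

noncomputable section

open scoped Classical AddSubgroup
set_option linter.dupNamespace false
namespace Summit.BirchSwinnertonDyer.BirchSwinnertonDyer.Theorems.ShimuraKolyvaginOrder

open CategoryTheory _root_.WeierstrassCurve Field Function NumberField IsDedekindDomain
open Literature.NumberTheory.EllipticCurves Literature.NumberTheory.EllipticCurves.KolyvaginDescent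
open Literature.NumberTheory.GaloisRepresentations Literature.NumberTheory.GaloisCohomology
open Literature.NumberTheory.GaloisRepresentations.DiscreteGaloisModule (mu MuCarrier pairing)
open Literature.GroupTheory.FiniteAbelian
open Summit.BirchSwinnertonDyer.BirchSwinnertonDyer.Theorems
open scoped ContRepresentation

/-! ### `Ш[m²] ⊆ Ш[m] ⟹ Ш[m^∞] = Ш[m]` (copies of the tree's private helpers of `…PrimaryShaBoundProofs`) -/

section Descent

variable {K : Type} [Field K] [NumberField K] {W : WeierstrassCurve K} {m : ℕ}

/-- **`Ш[m²] ⊆ Ш[m]` implies `Ш[m^{k+1}] ⊆ Ш[m]`** (induction: if `m^{k+2} a = 0` then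
`m² (m^k a) = 0`, so `m (m^k a) = m^{k+1} a = 0`). [folklore] -/
private theorem zsmul_eq_zero_of_pow_zsmul_eq_zero
    (hL : ∀ a ∈ W.sha, (((m * m : ℕ) : ℤ)) • a = 0 → (m : ℤ) • a = 0) :
    ∀ (k : ℕ), ∀ a ∈ W.sha, ((m : ℤ) ^ (k + 1)) • a = 0 → (m : ℤ) • a = 0 := by
  intro k
  induction k with
  | zero =>
    intro a _ h
    simpa only [zero_add, pow_one] using h
  | succ k ih =>
    intro a ha h
    refine ih a ha ?_
    have hb : ((m : ℤ) ^ k) • a ∈ W.sha := W.sha.zsmul_mem ha _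
    have h2 : (((m * m : ℕ) : ℤ)) • (((m : ℤ) ^ k) • a) = 0 := by
      rw [← mul_zsmul, Nat.cast_mul, show (m : ℤ) * m * (m : ℤ) ^ k = (m : ℤ) ^ (k + 1 + 1) by ring, h]
    have h3 := hL _ hb h2
    rwa [← mul_zsmul, ← pow_succ'] at h3

/-- **With `m = p^{M₀}`, `M₀ ≥ 1`: every class of `Ш(E/K)[p^∞]` is killed by `p^{M₀}`** (a class
killed by `p^j` is killed by `(p^{M₀})^{j+1}`, hence by `p^{M₀}`). Here `Ш(E/K)[p^∞]` is Mathlib's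
`AddCommGroup.primaryComponent`: the classes killed by some power of `p`. [folklore] -/
private theorem nsmul_eq_zero_of_mem_primaryComponent {p M₀ : ℕ} (hM₀ : 1 ≤ M₀)
    (hL : ∀ a ∈ W.sha, (((p ^ M₀ * p ^ M₀ : ℕ) : ℤ)) • a = 0 → ((p ^ M₀ : ℕ) : ℤ) • a = 0)
    {c : W.sha} (hc : c ∈ AddCommGroup.primaryComponent W.sha p) : p ^ M₀ • c = 0 := by
  obtain ⟨j, hj⟩ := (AddCommGroup.mem_primaryComponent).1 hc
  have hdvd : p ^ j ∣ (p ^ M₀) ^ (j + 1) := by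
    rw [← pow_mul]
    exact pow_dvd_pow p (by nlinarith)
  obtain ⟨d, hd⟩ := hdvd
  have hpow : (((p ^ M₀ : ℕ) : ℤ) ^ (j + 1)) • (c : W.galH1) = 0 := by
    rw [← Nat.cast_pow, hd, mul_comm, Nat.cast_mul, mul_zsmul, natCast_zsmul, natCast_zsmul,
      ← AddSubgroupClass.coe_nsmul, hj, ZeroMemClass.coe_zero, nsmul_zero]
  have key := zsmul_eq_zero_of_pow_zsmul_eq_zero (W := W) (m := p ^ M₀) hL j (c : W.galH1) c.2 hpow
  rw [natCast_zsmul, ← AddSubgroupClass.coe_nsmul] at key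
  exact_mod_cast key

/-- Hence **`Ш(E/K)[p^∞] = Ш(E/K)[p^{M₀}]`** as far as cardinality goes (the two subtypes are in
bijection by the identity on classes). [folklore] -/
private theorem card_primaryComponent_eq_card_torsionBy {p M₀ : ℕ} (hM₀ : 1 ≤ M₀)
    (hL : ∀ a ∈ W.sha, (((p ^ M₀ * p ^ M₀ : ℕ) : ℤ)) • a = 0 → ((p ^ M₀ : ℕ) : ℤ) • a = 0) :
    Nat.card (AddCommGroup.primaryComponent W.sha p) = Nat.card (W.sha)[(p ^ M₀ : ℕ)] :=
  Nat.card_congr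
    { toFun := fun c => ⟨c.1, AddSubgroup.torsionBy.nsmul_iff.2
        (nsmul_eq_zero_of_mem_primaryComponent hM₀ hL c.2)⟩
      invFun := fun x => ⟨x.1, (AddCommGroup.mem_primaryComponent).2
        ⟨M₀, AddSubgroup.torsionBy.nsmul_iff.1 x.2⟩⟩
      left_inv := fun _ => rfl
      right_inv := fun _ => rfl }

end Descent

/-! ### McCallum's §1 Theorem, order form, on `Ш(E/K)[p^∞]`, conductor-keyed -/

-- Cup products need `LocallyCompactSpace Γ_K`; as in the tree's Cassels–Tate files.
attribute [local instance] absoluteGaloisGroup_compactSpace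

-- `CharZero` of the completions (the Cassels–Tate local terms), as in the tree's files.
attribute [local instance] charZero_placeCompletion

variable (W : WeierstrassCurve ℚ) {K : Type} [Field K] [NumberField K]

/-- **Kolyvagin's theorem on `Ш(E/K)[p^∞]` (McCallum 1991, §1 Theorem, order form, upper bound), conductor-keyed**
— twin of `KolyvaginDescent.card_sha_primaryComponent_le_of_localTerm`: with `M₀ ≥ 1`, `p^{M₀} x₀ = Pt`,
`Ш(E/K)[p^∞]` is finite, killed by `p^{M₀}`, `#Ш(E/K)[p^∞] ≤ p^{2M₀}`, `ord_p #Ш(E/K)[p^∞] ≤ 2M₀` — GRANTED exactly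
the displayed inputs of `card_quotient_selmer_le_of_localTerm_of_conductorNorm`; the Heegner-point binder of the tree
replaced by `hN : W.conductorNorm ℤ = N₀`. Proof = the tree's (Kummer sequence `S_{m²}/ℤx ↠ Ш[m]`, `Ш[p^∞] = Ш[p^{M₀}]`).
[cite: McCallumLMS1991, §1 Theorem; Thm. 5.4, Cor. 5.6] [cite: GrossLMS1991, §2 Thm. 2.2 (2)]
[cite: MilneADT2006, Ch. I §6, (6.14), Prop. 6.9, Thm. 6.13(a)] -/
theorem card_sha_primaryComponent_le_of_localTerm_of_conductorNorm [W.IsElliptic]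
    (hK : IsImaginaryQuadratic K) {N₀ : ℕ} [NeZero N₀] (hN : W.conductorNorm ℤ = N₀)
    {Pt : (W.baseChange K).toAffine.Point}
    {p : ℕ} (hp : p.Prime) (hp2 : p ≠ 2) (hρ : W.HasSurjectiveModNGaloisRep p)
    (hC : Literature.NumberTheory.Automorphic.chebotarev_artinRep) (hW : W.exists_weilPairing p)
    {M₀ : ℕ} (hM₀ : 1 ≤ M₀) [NeZero (p ^ M₀)]
    (hdiv : ∀ Q : geomPoints (W.baseChange K), ∃ R, ((p ^ M₀ * p ^ M₀ : ℕ) : ℤ) • R = Q)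
    {c : K ≃ₐ[ℚ] K} (hc : c ≠ 1) (hcc : c * c = 1)
    {x₀ : (W.baseChange K).toAffine.Point} (hx₀ : p ^ M₀ • x₀ = Pt)
    (hPx : kummerMapTorsion (W.baseChange K) _ hdiv Pt =
      ((p : ℤ) ^ M₀) • kummerMapTorsion (W.baseChange K) _ hdiv x₀)
    (hxord : ((p : ℤ) ^ (2 * M₀ - 1)) • kummerMapTorsion (W.baseChange K) _ hdiv x₀ ≠ 0)
    (ε : ℤ) (hε : ε = 1 ∨ ε = -1)
    (h53 : IsOfFinAddOrder (Affine.Point.map (W' := W) (c : K →ₐ[ℚ] K) Pt - ε • Pt))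
    (cl : ℕ → galH1Torsion (W.baseChange K) ((p ^ M₀ * p ^ M₀ : ℕ) : ℤ))
    (hc1 : cl 1 = kummerMapTorsion (W.baseChange K) _ hdiv Pt)
    (hcl : ∀ m : ℕ, Squarefree m →
      (∀ q ∈ m.primeFactors, IsKolyvaginPrime N₀ W K p q ∧ FrobEqFrobInfty W K (p ^ M₀ * p ^ M₀) q) →
      conjAct W c _ (cl m) = (ε * (-1) ^ m.primeFactors.card) • cl m ∧
      (∀ v : HeightOneSpectrum (𝓞 K), (m : 𝓞 K) ∉ v.asIdeal →
        cl m ∈ selmerLocalKer (W.baseChange K) (v.adicCompletion K) ((p ^ M₀ * p ^ M₀ : ℕ) : ℤ)) ∧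
      (∀ ℓ : ℕ, ℓ.Prime → ℓ ∣ m → ∀ v : HeightOneSpectrum (𝓞 K), (ℓ : 𝓞 K) ∈ v.asIdeal →
        ∀ a : ℕ, (((p : ℤ) ^ a) • cl m ∈
            selmerLocalKer (W.baseChange K) (v.adicCompletion K) ((p ^ M₀ * p ^ M₀ : ℕ) : ℤ) ↔
          ((p : ℤ) ^ a) • cl (m / ℓ) ∈
            (W.baseChange K).torsionLocalKer (v.adicCompletion K) ((p ^ M₀ * p ^ M₀ : ℕ) : ℤ))))
    (hdual : ∀ ℓ : ℕ, IsKolyvaginPrime N₀ W K p ℓ ∧ FrobEqFrobInfty W K (p ^ M₀ * p ^ M₀) ℓ →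
      ∀ ν : ℤ, (ν = 1 ∨ ν = -1) → ∀ d : galH1Torsion (W.baseChange K) ((p ^ M₀ * p ^ M₀ : ℕ) : ℤ),
      conjAct W c _ d = ν • d →
      (∀ v : HeightOneSpectrum (𝓞 K), (ℓ : 𝓞 K) ∉ v.asIdeal →
        d ∈ selmerLocalKer (W.baseChange K) (v.adicCompletion K) ((p ^ M₀ * p ^ M₀ : ℕ) : ℤ)) →
      (∀ w : InfinitePlace K,
        d ∈ selmerLocalKer (W.baseChange K) w.Completion ((p ^ M₀ * p ^ M₀ : ℕ) : ℤ)) →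
      ∀ s ∈ selmerGroup (W.baseChange K) ((p ^ M₀ * p ^ M₀ : ℕ) : ℤ), conjAct W c _ s = ν • s →
      ∀ a : ℕ, a < 2 * M₀ → ∀ v : HeightOneSpectrum (𝓞 K), (ℓ : 𝓞 K) ∈ v.asIdeal →
        ((p : ℤ) ^ a) • d ∉
          selmerLocalKer (W.baseChange K) (v.adicCompletion K) ((p ^ M₀ * p ^ M₀ : ℕ) : ℤ) →
        ((p : ℤ) ^ (2 * M₀ - 1 - a)) • s ∈
          (W.baseChange K).torsionLocalKer (v.adicCompletion K) ((p ^ M₀ * p ^ M₀ : ℕ) : ℤ))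
    -- the Cassels–Tate inputs at level `m = p^{M₀}`, auxiliary level `m² = p^M`
    (e : geomTorsion (W.baseChange K) ((p ^ M₀ * p ^ M₀ : ℕ) : ℤ) →
      geomTorsion (W.baseChange K) ((p ^ M₀ * p ^ M₀ : ℕ) : ℤ) → AlgebraicClosure K)
    (hμ : ∀ S T, e S T ^ (p ^ M₀ * p ^ M₀) = 1)
    (hadd₁ : ∀ S₁ S₂ T, e (S₁ + S₂) T = e S₁ T * e S₂ T)
    (hadd₂ : ∀ S T₁ T₂, e S (T₁ + T₂) = e S T₁ * e S T₂)
    (hgal : ∀ (σ : absoluteGaloisGroup K) (S T : geomTorsion (W.baseChange K) ((p ^ M₀ * p ^ M₀ : ℕ) : ℤ)),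
      σ • e S T = e (σ • S) (σ • T))
    (halt : ∀ T, e T T = 1)
    (inv : LocalInvariants K (p ^ M₀ * p ^ M₀)) (hPT' : inv.SumInvLocalizationEqZero)
    (hH3 : ∀ x : galoisCohomology (mu K (p ^ M₀ * p ^ M₀)) 3,
      (∀ v : Place K, galoisCohomology.localization (mu K (p ^ M₀ * p ^ M₀)) v 3 x = 0) → x = 0)
    (hB : IsLevelPairing (p ^ M₀)
      (ctLevelPairing (W.baseChange K) (p ^ M₀) e hμ hadd₁ hadd₂ hgal inv halt hPT' hH3
        (localTerm_finite_support (W := W.baseChange K) (m := p ^ M₀) (e := e) (hμ := hμ)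
          (hadd₁ := hadd₁) (hadd₂ := hadd₂) (hgal := hgal) halt inv)))
    (hPτ : ∀ z ∈ selmerGroup (W.baseChange K) ((p ^ M₀ * p ^ M₀ : ℕ) : ℤ),
      ∀ t ∈ selmerGroup (W.baseChange K) ((p ^ M₀ * p ^ M₀ : ℕ) : ℤ),
      ctGeneralFun (W.baseChange K) (p ^ M₀) e hμ hadd₁ hadd₂ hgal inv
          (torsionH1ToH1 (W.baseChange K) _ (conjAct W c _ z))
          (torsionH1ToH1 (W.baseChange K) _ (conjAct W c _ t)) =
        ctGeneralFun (W.baseChange K) (p ^ M₀) e hμ hadd₁ hadd₂ hgal inv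
          (torsionH1ToH1 (W.baseChange K) _ z) (torsionH1ToH1 (W.baseChange K) _ t))
    -- Kolyvagin's annihilation, in the two forms used
    (hkill : ∀ s ∈ selmerGroup (W.baseChange K) ((p ^ M₀ * p ^ M₀ : ℕ) : ℤ),
      ((p : ℤ) ^ M₀) • s ∈ AddSubgroup.zmultiples (kummerMapTorsion (W.baseChange K) _ hdiv x₀))
    (hL : ∀ a ∈ (W.baseChange K).sha, (((p ^ M₀ * p ^ M₀ : ℕ) : ℤ)) • a = 0 → ((p ^ M₀ : ℕ) : ℤ) • a = 0)
    -- McCallum's Lemma 5.3 for the Cassels–Tate local term at `λ`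
    (hloc : ∀ ℓ m : ℕ,
      (hℓ : IsKolyvaginPrime N₀ W K p ℓ ∧ FrobEqFrobInfty W K (p ^ M₀ * p ^ M₀) ℓ) →
      KolSupp (fun q => IsKolyvaginPrime N₀ W K p q ∧ FrobEqFrobInfty W K (p ^ M₀ * p ^ M₀) q) (ℓ * m) →
      ¬ ℓ ∣ m →
      ∀ (j N a b : ℕ) (t : galH1Torsion (W.baseChange K) ((p ^ M₀ * p ^ M₀ : ℕ) : ℤ)),
      t ∈ selmerGroup (W.baseChange K) ((p ^ M₀ * p ^ M₀ : ℕ) : ℤ) →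
      ((p : ℤ) ^ j) • cl (ℓ * m) ∈ selmerGroup (W.baseChange K) ((p ^ M₀ * p ^ M₀ : ℕ) : ℤ) →
      ((p : ℤ) ^ N) • t = 0 →
      conjAct W c ((p ^ M₀ * p ^ M₀ : ℕ) : ℤ) t = (ε * (-1) ^ (ℓ * m).primeFactors.card) • t →
      (∀ q ∈ m.primeFactors, ∀ v : HeightOneSpectrum (𝓞 K), (q : 𝓞 K) ∈ v.asIdeal →
        t ∈ (W.baseChange K).torsionLocalKer (v.adicCompletion K) ((p ^ M₀ * p ^ M₀ : ℕ) : ℤ)) →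
      M₀ ≤ j → N ≤ M₀ → N ≤ j → a + b + 1 = N →
      (¬ ∀ v : HeightOneSpectrum (𝓞 K), (ℓ : 𝓞 K) ∈ v.asIdeal →
        ((p : ℤ) ^ (a + (j - N))) • cl m ∈
          (W.baseChange K).torsionLocalKer (v.adicCompletion K) ((p ^ M₀ * p ^ M₀ : ℕ) : ℤ)) →
      (¬ ∀ v : HeightOneSpectrum (𝓞 K), (ℓ : 𝓞 K) ∈ v.asIdeal →
        ((p : ℤ) ^ b) • t ∈ (W.baseChange K).torsionLocalKer (v.adicCompletion K) ((p ^ M₀ * p ^ M₀ : ℕ) : ℤ)) →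
      ∀ D : FirstCaseData (W.baseChange K) (p ^ M₀), D.b₁ = ((p : ℤ) ^ (j - M₀)) • cl (ℓ * m) →
        galoisCohomology.map (inclKD (W.baseChange K) (p ^ M₀) (p ^ M₀)) 1 D.b' = t →
        D.localTerm e hμ hadd₁ hadd₂ hgal inv (Sum.inr hℓ.1.place) ≠ 0) :
    Finite (AddCommGroup.primaryComponent (W.baseChange K).sha p) ∧
    (∀ c ∈ AddCommGroup.primaryComponent (W.baseChange K).sha p, p ^ M₀ • c = 0) ∧
    Nat.card (AddCommGroup.primaryComponent (W.baseChange K).sha p) ≤ p ^ (2 * M₀) ∧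
    padicValNat p (Nat.card (AddCommGroup.primaryComponent (W.baseChange K).sha p)) ≤ 2 * M₀ := by
  have hn0 : ((p ^ M₀ * p ^ M₀ : ℕ) : ℤ) ≠ 0 := by
    exact_mod_cast mul_ne_zero (NeZero.ne _) (NeZero.ne _)
  have hEND := card_quotient_selmer_le_of_localTerm_of_conductorNorm W hK hN hp hp2 hρ hC hW hM₀ hdiv hc
    hcc hx₀ hPx
    hxord ε hε h53 cl hc1 hcl hdual e hμ hadd₁ hadd₂ hgal halt inv hPT' hH3 hB hPτ hkill hL hloc
  haveI : Finite (selmerGroup (W.baseChange K) ((p ^ M₀ * p ^ M₀ : ℕ) : ℤ)) :=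
    (W.baseChange K).finite_selmerGroup_holds hn0
  obtain ⟨ι, hι⟩ := exists_selmerToShaTorsion (W.baseChange K) (p ^ M₀) hL
  have hx : torsionH1ToH1 (W.baseChange K) _ (kummerMapTorsion (W.baseChange K) _ hdiv x₀) = 0 :=
    torsionH1ToH1_kummerMapTorsion (W.baseChange K) _ hdiv x₀
  have hcard : Nat.card (AddCommGroup.primaryComponent (W.baseChange K).sha p) ≤ p ^ (2 * M₀) := by
    rw [card_primaryComponent_eq_card_torsionBy hM₀ hL]
    exact (card_shaTorsion_le_card_quotient ι hι hx).trans hEND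
  have hfin : Finite (AddCommGroup.primaryComponent (W.baseChange K).sha p) := by
    haveI : Finite ((W.baseChange K).sha)[(p ^ M₀ : ℕ)] := finite_shaTorsion_of_finite_selmerGroup ι hι
    exact Nat.finite_of_card_ne_zero (by
      rw [card_primaryComponent_eq_card_torsionBy hM₀ hL]
      exact Nat.card_pos.ne')
  refine ⟨hfin, fun c hc => nsmul_eq_zero_of_mem_primaryComponent hM₀ hL hc, hcard, ?_⟩
  exact (padicValNat_le_nat_log _).trans ((Nat.log_mono_right hcard).trans_eq (Nat.log_pow hp.one_lt _))

end Summit.BirchSwinnertonDyer.BirchSwinnertonDyer.Theorems.ShimuraKolyvaginOrder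
end
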